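import Literature.AnabelianGeometry.EtaleTheta.FrobenioidMonoTheta
import Literature.AnabelianGeometry.EtaleTheta.FrobenioidCyclotomicRigidityToy

/-!
# [EtTh] Lemma 5.8 as typed (`ConstantsEqNormalizer`, `KxRootNModCyclotome`): closed toy MODEL-WITNESSES

Mochizuki, *The étale theta function …*, Publ. RIMS **45** (2009), §5, Lemma 5.8 (Conjugation by
Constants), PRIMS p.331 (PDF p.105) [cite: MochizukiEtTh2009, Lem 5.8 p.331 (PDF p.105)].
abc-iut cell, block F, seat abc-iut-f-118 (float after tranche 118).  PROOF-ONLY companion of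
abc-iut-L2-t4's `FrobenioidMonoTheta.lean` over the closed toy of `FrobenioidCyclotomicRigidityToy.lean`
(`CyclotomicRigidityToy.toy n s`: `C = SingleObj (ℤ/n × ℤ/n)` over `SingleObj (ℤ/n)`, `O^×(S) = {1} × ℤ/n`,
`O^×(S^birat) = (ℤ/n × ℤ/n) × ℚ^×`, constants `ℚ^×` the last factor, level `N = n`).
FROZEN FACT-LIST rows **F-0536** (`ThetaFrobenioid.ConstantsEqNormalizer`: `(O_K^×)^{1/N} = O^×(B_N) ∩
N_{Aut_C(B_N)}(E_N)`) and **F-0538** (`ThetaFrobenioid.KxRootNModCyclotome`: the `N`-th power map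
`(K^×)^{1/N} → K^×` is onto with kernel the image of `μ_N(B_N)`) are SCHEMATA over the abstract §5
interface whose universal closures are ALREADY REFUTED in the tree (abc-iut-f-096,
`Discharge/Sec5Lem58UniversalClosureRefuted.lean`: `Lem58Toy.not_forall_constantsEqNormalizer`,
`Lem58Toy.not_forall_kxRootNModCyclotome`).  This file adds the complementary half of the R5 verdict —
the typed statements are SATISFIABLE at a closed instance:
* `constantsEqNormalizer_toy : (toy n s).ConstantsEqNormalizer` — at `toy n s` every unit is `n = N`-torsion,
  so `(O_K^×)^{1/N} = O^×(B_N)` (`OKxRootN_toy`), and `Aut_C(B_N) ≅ ℤ/n × ℤ/n` is abelian, so the normaliser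
  is everything (`normalizer_eq_top`);
* `kxRootNModCyclotome_toy_one : (toy 1 s).KxRootNModCyclotome` — the DEGENERATE level `N = 1` (every
  constant is its own first power; the `1`-torsion of `(K^×)^{1/1}` is trivial, as is `μ_1(B_N)`).
So both rows read «universal-closure REFUTED (f-096) / schema; instance form model-witnessed (toy)»; the
genuine instance (Kummer theory of the `p`-adic field `K`) stays with L2-t4's `constantsEqNormalizer_of`.
HONEST FRAMING: kernel statements about OUR typed interface at a toy; nothing here bears on, or takes a
side on, [IUTchIII] Cor. 3.12 or [EtTh] itself; a FACT row is an assumption label; typed ≠ proved.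
-/


namespace Literature.AnabelianGeometry.EtaleTheta

namespace CyclotomicRigidityToy

open CategoryTheory
open Literature.AlgebraicGeometry.Frobenioids

/-! ### `Aut_C(S)` is abelian at the toy: every subgroup is normal, every normaliser is everything -/

section Comm

variable (n : ℕ+)

/-- `Aut_C(S) ≅ ℤ/n × ℤ/n` is commutative. [cite: MochizukiEtTh2009, §5 p.331 (PDF p.105)] -/
theorem aut_mul_comm (S : CC n) (a b : Aut S) : a * b = b * a :=
  (autEquiv S).injective (by rw [map_mul, map_mul, mul_comm])

/-- Every subgroup of `Aut_C(S)` is normal at the toy. [cite: MochizukiEtTh2009, §5 p.331 (PDF p.105)] -/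
theorem subgroup_normal (S : CC n) (H : Subgroup (Aut S)) : H.Normal :=
  ⟨fun a ha b => by rwa [aut_mul_comm n S b a, mul_inv_cancel_right]⟩

/-- Every normaliser in `Aut_C(S)` is all of `Aut_C(S)` at the toy. [cite: MochizukiEtTh2009, Lem 5.8 p.331 (PDF p.105)] -/
theorem normalizer_eq_top (S : CC n) (H : Subgroup (Aut S)) : Subgroup.normalizer (H : Set (Aut S)) = ⊤ :=
  haveI := subgroup_normal n S H
  Subgroup.normalizer_eq_top H

end Comm

/-! ### F-0536 `ConstantsEqNormalizer` HOLDS at `toy n s` -/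

section Constants

variable (n : ℕ+) (s : Aut (SingleObj.star (Gn n)) →* Aut (SingleObj.star (Gn n × Gn n)))

/-- At `toy n s` every unit lies in `(O_K^×)^{1/N}`: its image `((1, g), 1)` in `O^×(B_N^birat)` is
`n = N`-torsion, so its `N`-th power is the constant `1`. [cite: MochizukiEtTh2009, Lem 5.8 p.331 (PDF p.105)] -/
theorem OKxRootN_toy : (toy n s).OKxRootN = (toy n s).units (toy n s).BN := by
  apply le_antisymm ((toy n s).OKxRootN_le_units)
  intro u hu
  refine ⟨⟨u, hu⟩, ?_, rfl⟩
  rw [SetLike.mem_coe, Subgroup.mem_comap, ThetaFrobenioid.mem_KxRootN, ← map_pow]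
  have h1 : (⟨u, hu⟩ : (toy n s).units (toy n s).BN) ^ ((toy n s).N : ℕ) = 1 :=
    Subtype.ext (pow_n_eq_one_of_mem_units n s _ u hu)
  rw [h1, map_one]
  exact one_mem _

/-- **(F-0536) model-witness: the typed Lemma 5.8 HOLDS at `toy n s`** — both sides are `O^×(B_N)`
(`OKxRootN_toy`; `Aut_C(B_N)` abelian). [cite: MochizukiEtTh2009, Lem 5.8 p.331 (PDF p.105)] -/
theorem constantsEqNormalizer_toy : (toy n s).ConstantsEqNormalizer := by
  rw [ThetaFrobenioid.ConstantsEqNormalizer, OKxRootN_toy, normalizer_eq_top, inf_top_eq]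

end Constants


/-! ### F-0538 `KxRootNModCyclotome` HOLDS at the degenerate `toy 1 s` -/


section KxOne

variable (s : Aut (SingleObj.star (Gn 1)) →* Aut (SingleObj.star (Gn 1 × Gn 1)))

/-- **(F-0538) degenerate model-witness: the typed clause HOLDS at `toy 1 s`** (`N = 1`: every constant
is its own first power; the only `1`-torsion element is `1`, which is the image of `μ_1(B_N) = 1`).
[cite: MochizukiEtTh2009, Lem 5.8 p.331 (PDF p.105)] -/
theorem kxRootNModCyclotome_toy_one : (toy 1 s).KxRootNModCyclotome := by
  have e : ∀ g : (toy 1 s).biratUnits (toy 1 s).BN, g ^ ((toy 1 s).N : ℕ) = g := fun g => pow_one g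
  refine ⟨fun k => ⟨(toy 1 s).constEmb k, ?_, e _⟩, fun f _ => ?_⟩
  · rw [ThetaFrobenioid.mem_KxRootN, e]
    exact ⟨k, rfl⟩
  · constructor
    · intro hf
      rw [e] at hf
      rw [hf]
      exact one_mem _
    · rintro ⟨u, rfl⟩
      rw [e]
      have hu : u = 1 := Subtype.ext ((pow_one (u : Aut (toy 1 s).BN)).symm.trans u.2.2)
      rw [hu, map_one]

end KxOne

end CyclotomicRigidityToy

end Literature.AnabelianGeometry.EtaleTheta
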